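import Summits.Ventures.Crystal3D.Bulk.RadiusTwoBarlowHolds
import Summits.Ventures.Crystal3D.Bulk.GapReductionSharp
import Mathlib.Analysis.Normed.Affine.MazurUlam
import HarnessLib

/-!
# Saturation structure of a general filling: close-packed shells, the residue rule, Barlow patches

HONEST FRAMING. Part of the venture `Summits/Ventures/Crystal3D` (cell `crystal3d-full`), helper for the
crux `GenericWallFloor` (stmt-Ventures-19480) of `route-Ventures-StickyWulffConstant`, REGISTERED line
`WallLedgerG` (planner cf-p1 gen 16), stub `stub_twoSlabAdhesion : TwoSlabAdhesion` (THE CRUX of the line).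
The rigid-bicrystal rung of the stub is landed (`rigid_twoSlabAdhesion_of_not_coaxial`); the general
(non-rigid) filling needs the venture's BULK saturation structure (cell `pub-crystal3d`, `Bulk/*`) in the
wall cell's own currency — a finite `1`-separated configuration `X : Finset ℝ³`, contacts at distance `1`,
degree `#{q ∈ X : dist x q = 1}`.  This file is that BRIDGE; nothing here is new mathematics.

Inputs, BY NAME (both are tree theorems of COMPUTATIONAL grade at `δ = 5/2`: `kissingClassification_250`,
and `KissingGap (5/2)` from `gapTupleDiam_125` via `gapTupleDiam_iff` / `kissingGap_of_gapTuple`; the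
statements below keep them as hypotheses `hg : KissingGap δ`, `hc : KissingClassification δ`, so the
axioms of this file are the standard ones):

* `closePacked_of_allButOne` — a ball with twelve contacts, all of whose neighbours but possibly one
  have twelve contacts, has a CLOSE-PACKED shell: its contact shell is the cuboctahedron
  (`fccKissingPattern`) or the anticuboctahedron (`hcpKissingPattern`) up to a linear isometry
  (`Bulk/GapReductionSharp.isClosePackedShell_of_gap_of_classification_allButOne`, Finset form);
  `exists_frame_of_allButOne` unpacks `IsArrangedIn` into "the twelve neighbours are `x + B p`".
* `two_unsaturated_of_not_closePacked` — the RESIDUE RULE: a saturated ball whose shell is not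
  close-packed has two distinct unsaturated neighbours.
* `eq_or_dist_eq_one_or_le_dist_of_saturated` — GAP at one ball: every other ball touches a saturated
  ball or stays at distance `≥ δ/2` from it.
* `barlowPatch_of_saturated_withinThree` — if every ball within contact distance `3` of `x` is
  saturated, the balls within contact distance `2` of `x` lie in ONE rigid image
  `(fun p => L p + s) '' barlowStacking 1 √(2/3) σ` of a close-packed stacking (`IsHaggSeq σ`) —
  the venture's radius-2 lemma `radiusTwoBarlow_holds`, in the affine-frame currency of the wall
  branch (`…GenericWallFloorShellCapture`, `…FramePropagation`, `…PatchTransfer`).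

WHAT THIS IS NOT: no statement about walls or the stub; rung F-C1 not moved.
-/

noncomputable section

namespace Summit.Ventures.Crystal3D.Theorems

open Summit.Ventures.Crystal3D Finset
open Literature.Geometry.DiscreteGeometry (fccKissingPattern hcpKissingPattern IsArrangedIn
  IsUnitBallPacking kissingShell mem_kissingShell_iff)
open Literature.MathematicalPhysics.StatisticalMechanics (barlowStacking IsHaggSeq)

variable {X : Finset (EuclideanSpace ℝ (Fin 3))}

/-! ### The doubled point set (Hales's normalisation: unit RADIUS, contact at distance `2`) -/

/-- The doubled configuration `2·X` is a packing of unit balls in Hales's sense. -/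
theorem isUnitBallPacking_two_smul_image (hX : ∀ p ∈ X, ∀ q ∈ X, p ≠ q → 1 ≤ dist p q) :
    IsUnitBallPacking ((fun p : EuclideanSpace ℝ (Fin 3) => (2 : ℝ) • p) '' (X : Set _)) := by
  rintro _ ⟨p, hp, rfl⟩ _ ⟨q, hq, rfl⟩ hd
  by_contra hne
  have hpq : p ≠ q := fun h => hne (by rw [h])
  have h1 := hX p hp q hq hpq
  rw [dist_smul₀, Real.norm_of_nonneg zero_le_two] at hd
  linarith

/-- The kissing shell of `2x` in `2·X` is the doubled contact shell of `x` in `X`. -/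
theorem kissingShell_two_smul_image (x : EuclideanSpace ℝ (Fin 3)) :
    kissingShell ((fun p : EuclideanSpace ℝ (Fin 3) => (2 : ℝ) • p) '' (X : Set _)) ((2 : ℝ) • x) =
      (fun q => (2 : ℝ) • (q - x)) '' {q | q ∈ X ∧ dist x q = 1} := by
  ext v
  rw [mem_kissingShell_iff]
  constructor
  · rintro ⟨⟨q, hq, hqv⟩, hv⟩
    have hqv : (2 : ℝ) • q = (2 : ℝ) • x + v := hqv
    have hv' : v = (2 : ℝ) • (q - x) := by rw [smul_sub, hqv]; abel
    refine ⟨q, ⟨hq, ?_⟩, hv'.symm⟩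
    rw [hv', norm_smul, Real.norm_of_nonneg zero_le_two, ← dist_eq_norm, dist_comm] at hv
    linarith
  · rintro ⟨q, ⟨hq, hd⟩, rfl⟩
    refine ⟨⟨q, hq, ?_⟩, ?_⟩
    · show (2 : ℝ) • q = (2 : ℝ) • x + (2 : ℝ) • (q - x)
      rw [smul_sub]; abel
    · show ‖(2 : ℝ) • (q - x)‖ = 2
      rw [norm_smul, Real.norm_of_nonneg zero_le_two, ← dist_eq_norm, dist_comm, hd, mul_one]

/-- The doubled contact shell has as many points as `x` has contacts. -/
theorem ncard_two_smul_sub_image (x : EuclideanSpace ℝ (Fin 3)) :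
    ((fun q => (2 : ℝ) • (q - x)) '' {q | q ∈ X ∧ dist x q = 1}).ncard =
      (X.filter fun q => dist x q = 1).card := by
  classical
  have hinj : Function.Injective (fun q : EuclideanSpace ℝ (Fin 3) => (2 : ℝ) • (q - x)) := by
    intro a b h
    have h' := smul_right_injective (EuclideanSpace ℝ (Fin 3)) (two_ne_zero (α := ℝ)) h
    simpa using h'
  rw [Set.ncard_image_of_injective _ hinj]
  have : {q | q ∈ X ∧ dist x q = 1} = ((X.filter fun q => dist x q = 1 : Finset _) : Set _) := by
    ext q; simp
  rw [this, Set.ncard_coe_finset]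

/-- A point of `2·X` at distance `2` from `2x` is `2y` for a contact neighbour `y ∈ X` of `x`. -/
theorem exists_eq_two_smul_of_dist_two {x w : EuclideanSpace ℝ (Fin 3)}
    (hw : w ∈ (fun p : EuclideanSpace ℝ (Fin 3) => (2 : ℝ) • p) '' (X : Set _))
    (hd : dist ((2 : ℝ) • x) w = 2) : ∃ y ∈ X, dist x y = 1 ∧ w = (2 : ℝ) • y := by
  obtain ⟨y, hy, rfl⟩ := hw
  refine ⟨y, hy, ?_, rfl⟩
  rw [dist_smul₀, Real.norm_of_nonneg zero_le_two] at hd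
  linarith

/-! ### Close-packed shells (all-but-one form) -/

/-- **Close-packed shell, all-but-one form.**  Under GAP(`δ`) and CLASSIFICATION(`δ`): in a finite
`1`-separated configuration `X`, a point `x` with twelve contacts, all of whose contact neighbours except
possibly `y₀` have twelve contacts, has its (doubled) contact shell arranged in the FCC pattern
(cuboctahedron) or the HCP pattern (anticuboctahedron). -/
theorem closePacked_of_allButOne {δ : ℝ} (hg : KissingGap δ) (hc : KissingClassification δ)
    (hX : ∀ p ∈ X, ∀ q ∈ X, p ≠ q → 1 ≤ dist p q) {x : EuclideanSpace ℝ (Fin 3)}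
    (h12 : (X.filter fun q => dist x q = 1).card = 12) (y₀ : EuclideanSpace ℝ (Fin 3))
    (hnb : ∀ y ∈ X, dist x y = 1 → y ≠ y₀ → (X.filter fun q => dist y q = 1).card = 12) :
    IsArrangedIn ((fun q => (2 : ℝ) • (q - x)) '' {q | q ∈ X ∧ dist x q = 1}) fccKissingPattern ∨
      IsArrangedIn ((fun q => (2 : ℝ) • (q - x)) '' {q | q ∈ X ∧ dist x q = 1}) hcpKissingPattern := by
  have hV := isUnitBallPacking_two_smul_image hX
  rw [← kissingShell_two_smul_image]
  refine hc _ (isGapKissingConfig_kissingShell_allButOne hg hV ?_ ((2 : ℝ) • y₀) fun w hw hd hw₀ => ?_)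
  · rw [kissingShell_two_smul_image, ncard_two_smul_sub_image, h12]
  · obtain ⟨y, hy, hxy, rfl⟩ := exists_eq_two_smul_of_dist_two hw hd
    have hyy₀ : y ≠ y₀ := fun h => hw₀ (by rw [h])
    rw [kissingShell_two_smul_image, ncard_two_smul_sub_image, hnb y hy hxy hyy₀]

/-- `IsArrangedIn` unpacked: the contact neighbours of `x` are exactly the twelve points `x + B p`,
`p` in the pattern, for a linear isometry `B`. -/
theorem neighbours_eq_of_isArrangedIn {x : EuclideanSpace ℝ (Fin 3)}
    {P : Finset (EuclideanSpace ℝ (Fin 3))}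
    (h : IsArrangedIn ((fun q => (2 : ℝ) • (q - x)) '' {q | q ∈ X ∧ dist x q = 1}) P) :
    ∃ B : EuclideanSpace ℝ (Fin 3) →ₗᵢ[ℝ] EuclideanSpace ℝ (Fin 3),
      (∀ p ∈ P, x + B p ∈ X ∧ dist x (x + B p) = 1) ∧
      ∀ q ∈ X, dist x q = 1 → ∃ p ∈ P, q = x + B p := by
  obtain ⟨B, hB⟩ := h
  refine ⟨B, fun p hp => ?_, fun q hq hd => ?_⟩
  · have hmem : (2 : ℝ) • B p ∈ (fun q => (2 : ℝ) • (q - x)) '' {q | q ∈ X ∧ dist x q = 1} := by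
      rw [hB]; exact ⟨p, hp, rfl⟩
    obtain ⟨q, ⟨hq, hd⟩, hqe⟩ := hmem
    have hqe : (2 : ℝ) • (q - x) = (2 : ℝ) • B p := hqe
    have hq' : q = x + B p := by
      have := smul_right_injective (EuclideanSpace ℝ (Fin 3)) (two_ne_zero (α := ℝ)) hqe
      rw [← this]; abel
    exact ⟨hq' ▸ hq, hq' ▸ hd⟩
  · have hmem : (2 : ℝ) • (q - x) ∈ (fun p => (2 : ℝ) • B p) '' (P : Set _) := by
      rw [← hB]; exact ⟨q, ⟨hq, hd⟩, rfl⟩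
    obtain ⟨p, hp, hpe⟩ := hmem
    have hpe : (2 : ℝ) • B p = (2 : ℝ) • (q - x) := hpe
    refine ⟨p, hp, ?_⟩
    have := smul_right_injective (EuclideanSpace ℝ (Fin 3)) (two_ne_zero (α := ℝ)) hpe
    rw [this]; abel

/-- **Close-packed shell, frame form.**  Under GAP(`δ`) ∧ CLASSIFICATION(`δ`), a point with twelve
contacts and at most one unsaturated contact neighbour has its twelve neighbours at `x + B p`, `p` running
over the cuboctahedron `fccKissingPattern` or over the anticuboctahedron `hcpKissingPattern`, for some
linear isometry `B` of `ℝ³`. -/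
theorem exists_frame_of_allButOne {δ : ℝ} (hg : KissingGap δ) (hc : KissingClassification δ)
    (hX : ∀ p ∈ X, ∀ q ∈ X, p ≠ q → 1 ≤ dist p q) {x : EuclideanSpace ℝ (Fin 3)}
    (h12 : (X.filter fun q => dist x q = 1).card = 12) (y₀ : EuclideanSpace ℝ (Fin 3))
    (hnb : ∀ y ∈ X, dist x y = 1 → y ≠ y₀ → (X.filter fun q => dist y q = 1).card = 12) :
    ∃ (P : Finset (EuclideanSpace ℝ (Fin 3))) (B : EuclideanSpace ℝ (Fin 3) →ₗᵢ[ℝ] EuclideanSpace ℝ (Fin 3)),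
      (P = fccKissingPattern ∨ P = hcpKissingPattern) ∧
      (∀ p ∈ P, x + B p ∈ X ∧ dist x (x + B p) = 1) ∧
      ∀ q ∈ X, dist x q = 1 → ∃ p ∈ P, q = x + B p := by
  rcases closePacked_of_allButOne hg hc hX h12 y₀ hnb with h | h
  · obtain ⟨B, h1, h2⟩ := neighbours_eq_of_isArrangedIn h
    exact ⟨fccKissingPattern, B, Or.inl rfl, h1, h2⟩
  · obtain ⟨B, h1, h2⟩ := neighbours_eq_of_isArrangedIn h
    exact ⟨hcpKissingPattern, B, Or.inr rfl, h1, h2⟩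

/-! ### The residue rule and the gap at one ball -/

/-- **Residue rule.**  Under GAP(`δ`) ∧ CLASSIFICATION(`δ`): a point with twelve contacts whose shell is
NOT close-packed has two distinct contact neighbours with fewer than twelve contacts each. -/
theorem two_unsaturated_of_not_closePacked {δ : ℝ} (hg : KissingGap δ) (hc : KissingClassification δ)
    (hX : ∀ p ∈ X, ∀ q ∈ X, p ≠ q → 1 ≤ dist p q) {x : EuclideanSpace ℝ (Fin 3)}
    (h12 : (X.filter fun q => dist x q = 1).card = 12)
    (hnot : ¬ (IsArrangedIn ((fun q => (2 : ℝ) • (q - x)) '' {q | q ∈ X ∧ dist x q = 1}) fccKissingPattern ∨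
      IsArrangedIn ((fun q => (2 : ℝ) • (q - x)) '' {q | q ∈ X ∧ dist x q = 1}) hcpKissingPattern)) :
    ∃ y ∈ X, ∃ y' ∈ X, y ≠ y' ∧ dist x y = 1 ∧ dist x y' = 1 ∧
      (X.filter fun q => dist y q = 1).card ≠ 12 ∧ (X.filter fun q => dist y' q = 1).card ≠ 12 := by
  have h1 : ∃ y ∈ X, dist x y = 1 ∧ (X.filter fun q => dist y q = 1).card ≠ 12 := by
    by_contra h
    push Not at h
    exact hnot (closePacked_of_allButOne hg hc hX h12 x fun y hy hd _ => h y hy hd)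
  obtain ⟨y, hy, hxy, hy12⟩ := h1
  have h2 : ∃ y' ∈ X, y' ≠ y ∧ dist x y' = 1 ∧ (X.filter fun q => dist y' q = 1).card ≠ 12 := by
    by_contra h
    push Not at h
    exact hnot (closePacked_of_allButOne hg hc hX h12 y fun y' hy' hd hne => h y' hy' hne hd)
  obtain ⟨y', hy', hne, hxy', hy'12⟩ := h2
  exact ⟨y, hy, y', hy', hne.symm, hxy, hxy', hy12, hy'12⟩

/-- **GAP at one ball.**  Under GAP(`δ`): a point `x ∈ X` with twelve contacts has every other point of
`X` touching it or at distance `≥ δ/2` (`δ/2 = 5/4` for the tree's `KissingGap (5/2)`). -/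
theorem eq_or_dist_eq_one_or_le_dist_of_saturated {δ : ℝ} (hg : KissingGap δ)
    (hX : ∀ p ∈ X, ∀ q ∈ X, p ≠ q → 1 ≤ dist p q) {x : EuclideanSpace ℝ (Fin 3)} (hx : x ∈ X)
    (h12 : (X.filter fun q => dist x q = 1).card = 12) {q : EuclideanSpace ℝ (Fin 3)} (hq : q ∈ X) :
    q = x ∨ dist x q = 1 ∨ δ / 2 ≤ dist x q := by
  have hV := isUnitBallPacking_two_smul_image hX
  have h := hg _ hV ((2 : ℝ) • x) ⟨x, hx, rfl⟩
    (by rw [kissingShell_two_smul_image, ncard_two_smul_sub_image, h12]) ((2 : ℝ) • q) ⟨q, hq, rfl⟩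
  rw [dist_smul₀, Real.norm_of_nonneg zero_le_two] at h
  rcases h with h | h | h
  · left
    have := smul_right_injective (EuclideanSpace ℝ (Fin 3)) (two_ne_zero (α := ℝ)) h
    simpa using this.symm
  · exact Or.inr (Or.inl (by linarith))
  · exact Or.inr (Or.inr (by linarith))

/-! ### Barlow patches from radius-three saturation -/

/-- The enumeration of `X` as a labelled configuration. -/
theorem isUnitPacking_enum (hX : ∀ p ∈ X, ∀ q ∈ X, p ≠ q → 1 ≤ dist p q) :
    IsUnitPacking (fun i : Fin (Fintype.card X) =>
      (((Fintype.equivFin X).symm i : X) : EuclideanSpace ℝ (Fin 3))) := by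
  intro i j hij
  apply hX _ ((Fintype.equivFin X).symm i).2 _ ((Fintype.equivFin X).symm j).2
  intro h
  exact hij ((Fintype.equivFin X).symm.injective (Subtype.ext h))

/-- The coordination number of a label is the contact count of its point. -/
theorem coordination_enum (hX : ∀ p ∈ X, ∀ q ∈ X, p ≠ q → 1 ≤ dist p q) (i : Fin (Fintype.card X)) :
    coordination (fun i : Fin (Fintype.card X) =>
        (((Fintype.equivFin X).symm i : X) : EuclideanSpace ℝ (Fin 3))) i =
      (X.filter fun q => dist ((((Fintype.equivFin X).symm i : X) : EuclideanSpace ℝ (Fin 3))) q = 1).card := by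
  classical
  set xs : Fin (Fintype.card X) → EuclideanSpace ℝ (Fin 3) :=
    fun i => (((Fintype.equivFin X).symm i : X) : EuclideanSpace ℝ (Fin 3)) with hxs
  have hinj : Function.Injective xs := (isUnitPacking_enum hX).injective
  rw [coordination, ← Finset.card_image_of_injective _ hinj]
  congr 1
  ext q
  simp only [mem_image, mem_contactNeighbors, mem_filter]
  constructor
  · rintro ⟨j, ⟨-, hd⟩, rfl⟩
    exact ⟨((Fintype.equivFin X).symm j).2, hd⟩
  · rintro ⟨hq, hd⟩
    refine ⟨Fintype.equivFin X ⟨q, hq⟩, ⟨?_, ?_⟩, ?_⟩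
    · intro h
      have : q = xs i := by
        have := congrArg (fun k => xs k) h
        simpa [hxs] using this
      rw [this, dist_self] at hd
      exact zero_ne_one hd
    · simpa [hxs] using hd
    · simp [hxs]

/-- **Barlow patch from radius-three saturation.**  Under GAP(`δ`) ∧ CLASSIFICATION(`δ`): if every
point of `X` within contact distance `3` of `x ∈ X` has twelve contacts, then the points of `X` within
contact distance `2` of `x` lie in one rigid image `(fun p => L p + s) '' barlowStacking 1 √(2/3) σ` of a
close-packed stacking (`IsHaggSeq σ`) — `radiusTwoBarlow_holds` after `closePacked` shells are supplied
by `isClosePackedShell_of_gap_of_classification`. -/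
theorem barlowPatch_of_saturated_withinThree {δ : ℝ} (hg : KissingGap δ) (hc : KissingClassification δ)
    (hX : ∀ p ∈ X, ∀ q ∈ X, p ≠ q → 1 ≤ dist p q) {x : EuclideanSpace ℝ (Fin 3)} (hx : x ∈ X)
    (hsat : ∀ y ∈ X,
      (y = x ∨ dist x y = 1 ∨ (∃ z ∈ X, dist x z = 1 ∧ dist z y = 1) ∨
        ∃ z ∈ X, ∃ z' ∈ X, dist x z = 1 ∧ dist z z' = 1 ∧ dist z' y = 1) →
      (X.filter fun q => dist y q = 1).card = 12) :
    ∃ σ : ℤ → ℤ, IsHaggSeq σ ∧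
      ∃ (L : EuclideanSpace ℝ (Fin 3) ≃ₗᵢ[ℝ] EuclideanSpace ℝ (Fin 3)) (s : EuclideanSpace ℝ (Fin 3)),
        ∀ y ∈ X, (y = x ∨ dist x y = 1 ∨ ∃ z ∈ X, dist x z = 1 ∧ dist z y = 1) →
          y ∈ (fun p => L p + s) '' barlowStacking 1 (Real.sqrt (2 / 3)) σ := by
  classical
  set xs : Fin (Fintype.card X) → EuclideanSpace ℝ (Fin 3) :=
    fun i => (((Fintype.equivFin X).symm i : X) : EuclideanSpace ℝ (Fin 3)) with hxs
  have hxsP : IsUnitPacking xs := isUnitPacking_enum hX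
  have hmem : ∀ j, xs j ∈ X := fun j => ((Fintype.equivFin X).symm j).2
  have hxs_at : ∀ q (hq : q ∈ X), xs (Fintype.equivFin X ⟨q, hq⟩) = q := fun q hq => by simp [hxs]
  set i₀ : Fin (Fintype.card X) := Fintype.equivFin X ⟨x, hx⟩ with hi₀
  have hx₀ : xs i₀ = x := hxs_at x hx
  -- contact neighbours in the two languages
  have nbr : ∀ {a b}, b ∈ contactNeighbors xs a → dist (xs a) (xs b) = 1 :=
    fun h => ((mem_contactNeighbors xs).1 h).2
  have coord : ∀ j, coordination xs j = (X.filter fun q => dist (xs j) q = 1).card :=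
    fun j => coordination_enum hX j
  -- every ball within two of `i₀` has all its neighbours saturated, hence a close-packed shell
  have hcp : ∀ j, WithinTwo xs i₀ j → IsClosePackedShell xs j := by
    intro j hj
    have hj' : xs j = x ∨ dist x (xs j) = 1 ∨ ∃ z ∈ X, dist x z = 1 ∧ dist z (xs j) = 1 := by
      rcases hj with rfl | hj | ⟨k, hk, hjk⟩
      · exact Or.inl hx₀
      · exact Or.inr (Or.inl (by rw [← hx₀]; exact nbr hj))
      · exact Or.inr (Or.inr ⟨xs k, hmem k, by rw [← hx₀]; exact nbr hk, nbr hjk⟩)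
    refine isClosePackedShell_of_gap_of_classification hg hc hxsP ?_ fun k hk => ?_
    · rw [coord]
      exact hsat (xs j) (hmem j) (by
        rcases hj' with h | h | h
        · exact Or.inl h
        · exact Or.inr (Or.inl h)
        · exact Or.inr (Or.inr (Or.inl h)))
    · rw [coord]
      refine hsat (xs k) (hmem k) ?_
      have hdk := nbr hk
      rcases hj' with h | h | ⟨z, hz, hxz, hzj⟩
      · exact Or.inr (Or.inl (by rw [← h]; exact hdk))
      · exact Or.inr (Or.inr (Or.inl ⟨xs j, hmem j, h, hdk⟩))
      · exact Or.inr (Or.inr (Or.inr ⟨z, hz, xs j, hmem j, hxz, hzj, hdk⟩))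
  obtain ⟨σ, hσ, g, hg'⟩ := radiusTwoBarlow_holds _ xs hxsP i₀ hcp
  -- the isometry `g⁻¹` is affine: `g⁻¹ p = L p + s`
  set f := g.symm.toRealAffineIsometryEquiv with hf
  refine ⟨σ, hσ, f.linearIsometryEquiv, g.symm 0, fun y hy hwy => ?_⟩
  -- `y = xs j` for a label `j` within two of `i₀`
  set j : Fin (Fintype.card X) := Fintype.equivFin X ⟨y, hy⟩ with hj
  have hyj : xs j = y := hxs_at y hy
  have hwj : WithinTwo xs i₀ j := by
    rcases hwy with h | h | ⟨z, hz, hxz, hzy⟩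
    · left
      apply hxsP.injective
      rw [hyj, hx₀, h]
    · right; left
      refine (mem_contactNeighbors xs).2 ⟨fun hji => ?_, by rw [hx₀, hyj]; exact h⟩
      rw [hji, hx₀] at hyj
      rw [← hyj, dist_self] at h
      exact zero_ne_one h
    · right; right
      refine ⟨Fintype.equivFin X ⟨z, hz⟩, (mem_contactNeighbors xs).2 ⟨fun hzi => ?_, ?_⟩,
        (mem_contactNeighbors xs).2 ⟨fun hjz => ?_, ?_⟩⟩
      · have : z = x := by rw [← hx₀, ← hzi, hxs_at z hz]
        rw [this, dist_self] at hxz; exact zero_ne_one hxz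
      · rw [hx₀, hxs_at z hz]; exact hxz
      · have : y = z := by rw [← hyj, hjz, hxs_at z hz]
        rw [this, dist_self] at hzy; exact zero_ne_one hzy
      · rw [hxs_at z hz, hyj]; exact hzy
  have hgy := hg' j hwj
  rw [hyj] at hgy
  refine ⟨g y, hgy, ?_⟩
  have e1 : f (g y) = y := by
    rw [hf, IsometryEquiv.coeFn_toRealAffineIsometryEquiv]
    exact g.symm_apply_apply y
  have e3 : f 0 = g.symm 0 := by
    rw [hf, IsometryEquiv.coeFn_toRealAffineIsometryEquiv]
  have e2 : f (g y) = f.linearIsometryEquiv (g y) + g.symm 0 := by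
    have h := f.map_vadd (0 : EuclideanSpace ℝ (Fin 3)) (g y)
    rw [vadd_eq_add, add_zero, vadd_eq_add] at h
    rw [h, e3]
  show f.linearIsometryEquiv (g y) + g.symm 0 = y
  rw [← e2, e1]

end Summit.Ventures.Crystal3D.Theorems

end
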